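/-
Copyright (c) 2026 the pub-hodgecm-mathlib formalisation cell (harness21).  Prover seat hodgecm-mathlib-R90-C131-p02 (g0) (R90-TF S4 hand lent to L1
by CHAIR VALVE WORD W4), Track B «K2-LIT», hLiu418 = `stmt-HodgeConjecture-24832`; K1-a♮ line lead K2E5-p16 (g8) WORD #11 (α)/(b).  THEOREMS ONLY (no `def`,
no instance, no notation, no named-fact hypothesis, no `sorry`); lane `--supports stmt-HodgeConjecture-24832 --as helper`.
-/
import Summits.HodgeConjecture.HodgeConjecture.Theorems.K2LiuArchTwistedScalarBlockContinuationNeg   -- ★ p863677 (3c-cont⁻) the `∃ E` version, `T ≤ 0`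
import HarnessLib

/-!
# Crux `HLiu418`, (Φ-S1) road B, file (iii-a⁻): the twisted archimedean block of the scalar type at a NEGATIVE rank-one index — the continued value as an
# `h`-EXPLICIT formula through a joint continuation witness `Φ` along the swapped K1 line `(1 − k/2, 1 + k/2)` (sign twin of ★ p863574)

Cell `hodgecm-mathlib`, crux item hLiu418 = `stmt-HodgeConjecture-24832` (helper lane, count-neutral).  As ★ p863574 `twistedArchBlock_scalarType_eq_continued`
but for `T = −a·diag(t,0)·aᴴ`: ★ `xiTwo_eq_etaTwo_of_neg_posSemidef` swaps the parameters, the continued letter is `Φ (1 − k/2) (1 + k/2) p s` (★ (ii) at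
`α₀ = 1 − k/2`, `β₀ = 1 + k/2`; strip `{1 − N < re(1 + k/2 + s)} ⊇ {0 < re s}` for `−k/2 < N`), and the `Γ₂` factors regroup as `π⁻¹Γ(α)⁻¹ · π⁻¹Γ(β)⁻¹Γ(β−1)⁻¹`.
* §1 **`twistedArchBlock_scalarType_eq_continued_neg`**.

HONEST LABEL: scalar `K_w`-type; closes no socket.  HC_CM is proved only modulo the 7 printed citations (2 remaining named inputs: hLiu418 =
`stmt-HodgeConjecture-24832`, h413 = `stmt-HodgeConjecture-24833`) until rung 0 closes.  REL ≠ ★ ≠ BUILT.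

## References
* [Shimura1982] G. Shimura, *Confluent hypergeometric functions on tube domains*, Math. Ann. 260 (1982), (1.28), §3 Thm. 3.1, §4 Thm. 4.2.
* [Shimura1997] G. Shimura, *Euler Products and Eisenstein Series*, CBMS 93 (1997), §16.4, §18.4–18.5.
-/

set_option autoImplicit false
set_option linter.dupNamespace false

noncomputable section

open Complex MeasureTheory Set Matrix Filter
open scoped ComplexOrder ComplexConjugate Topology

namespace Summit.HodgeConjecture.HodgeConjecture.Cruxes.HLiu418.K2LiuArchTwistedScalarBlockExplicitNeg

open Literature.NumberTheory.ModularForms.SiegelUpperHalfSpace (num denom moeb)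
open Summit.HodgeConjecture.HodgeConjecture.Cruxes.HLiu418.K2LiuHermTwoGammaDefs
open Summit.HodgeConjecture.HodgeConjecture.Cruxes.HLiu418.K2LiuHermTwoEtaDefs
open Summit.HodgeConjecture.HodgeConjecture.Cruxes.HLiu418.K2LiuHermTwoConfluentXiDefs
open Summit.HodgeConjecture.HodgeConjecture.Cruxes.HLiu418.K2LiuHermitianTubeCocycle
open Summit.HodgeConjecture.HodgeConjecture.Cruxes.HLiu418.K2LiuArchInducedTubeDefs
open Summit.HodgeConjecture.HodgeConjecture.Cruxes.HLiu418.K2LiuHermTwoEtaRankOneReduction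
open Summit.HodgeConjecture.HodgeConjecture.Cruxes.HLiu418.K2LiuHermTwoXiEtaIdentitySemidefinite
open Summit.HodgeConjecture.HodgeConjecture.Cruxes.HLiu418.K2LiuHermTwoXiEtaSymmetry
open Summit.HodgeConjecture.HodgeConjecture.Cruxes.HLiu418.K2LiuHermTwoConfluentXiHolomorphy
open Summit.HodgeConjecture.HodgeConjecture.Cruxes.HLiu418.K2LiuArchTwistedIntertwiningScalarSection
open Summit.HodgeConjecture.HodgeConjecture.Cruxes.HLiu418.K2LiuLocalKernelArchPlaceFactor (differentiableOn_Gamma_two_mul)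
open Summit.HodgeConjecture.HodgeConjecture.Cruxes.HLiu418.K2LiuArchTwistedScalarBlockContinuation
open Summit.HodgeConjecture.HodgeConjecture.Cruxes.HLiu418.K2LiuArchTwistedScalarBlockContinuationNeg

/-! ## §1 The continued value at a negative index, explicit in the point -/

/-- **(iii-a⁻) THE CONTINUED TWISTED BLOCK OF THE SCALAR TYPE AT A NEGATIVE RANK-ONE INDEX, EXPLICIT IN THE POINT.**  For `h ∈ U(J)`, `k : ℤ`,
`T = −a·diag(t,0)·aᴴ` (`‖det a‖ = 1`, `t > 0`), `N : ℕ` with `−k/2 < N`, the weight coordinates `(p, w, q)` of `aᴴ(2V)a`, and ANY `Φ` with ★ (ii)(a)(b):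
for every `s` with `½ < re s`, the twisted block equals the displayed product `· Φ (1 − k/2) (1 + k/2) p s`. [Shimura1982, (1.28), §4 Thm. 4.2; §3 Thm. 3.1] -/
theorem twistedArchBlock_scalarType_eq_continued_neg (k : ℤ) {h : Matrix (Fin 2 ⊕ Fin 2) (Fin 2 ⊕ Fin 2) ℂ}
    (hh : hᴴ * Matrix.J (Fin 2) ℂ * h = Matrix.J (Fin 2) ℂ) {a : Matrix (Fin 2) (Fin 2) ℂ} (hdet : ‖a.det‖ = 1) {t : ℝ} (ht : 0 < t)
    {N : ℕ} (hN : -(k : ℝ) / 2 < N) {p q : ℝ} {w : ℂ}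
    (he : hermTwo (p, w, q) = aᴴ * ((2 : ℂ) • ((2 * I)⁻¹ • (moeb h (I • (1 : Matrix (Fin 2) (Fin 2) ℂ)) - (moeb h (I • (1 : Matrix (Fin 2) (Fin 2) ℂ)))ᴴ))) * a)
    (Φ : ℂ → ℂ → ℝ → ℂ → ℂ)
    (hΦa : ∀ (α₀ β₀ : ℂ) (p' : ℝ), 0 < p' → DifferentiableOn ℂ (Φ α₀ β₀ p') {s : ℂ | 1 - N < (β₀ + s).re})
    (hΦb : ∀ (α₀ β₀ : ℂ) (p' : ℝ), 0 < p' → ∀ s : ℂ, 1 < (β₀ + s).re → Φ α₀ β₀ p' s = (Complex.Gamma (β₀ + s - 1))⁻¹ *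
      ∫ r in Ioi (0 : ℝ), cexp (-((p' * r : ℝ) : ℂ)) * ((((r + 2 * (Real.pi * t) : ℝ)) : ℂ) ^ (α₀ + s - 2) * ((r : ℝ) : ℂ) ^ (β₀ + s - 2)))
    {s : ℂ} (hs : 1 / 2 < s.re) :
    (∫ r : Fin 2 → Fin 2 → ℝ, cexp (-(2 * Real.pi * I) * ((-(a * hermTwo (t, 0, 0) * aᴴ)) * hermOfReal r).trace) *
        archScalarSection k s (Matrix.J (Fin 2) ℂ * fromBlocks 1 (hermOfReal r) 0 1 * h)) =
      ((denom h (I • (1 : Matrix (Fin 2) (Fin 2) ℂ))).det ^ (-k) *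
          (((‖(denom h (I • (1 : Matrix (Fin 2) (Fin 2) ℂ))).det‖ : ℝ)) : ℂ) ^ ((k : ℂ) - 2 * s - 2) *
          cexp ((2 * Real.pi * I) * ((-(a * hermTwo (t, 0, 0) * aᴴ)) *
            ((2 : ℂ)⁻¹ • (moeb h (I • (1 : Matrix (Fin 2) (Fin 2) ℂ)) + (moeb h (I • (1 : Matrix (Fin 2) (Fin 2) ℂ)))ᴴ))).trace)) *
        ((1 / 8 : ℂ) * ((((4 * Real.pi ^ 4 : ℝ)) : ℂ) * cexp ((Real.pi * I) * ((s + 1 - k / 2) - (s + 1 + k / 2))) *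
          ((Real.pi : ℂ)⁻¹ * (Complex.Gamma (s + 1 + k / 2))⁻¹) *
          ((Real.pi : ℂ)⁻¹ * (Complex.Gamma (s + 1 - k / 2))⁻¹ * (Complex.Gamma (s + 1 - k / 2 - 1))⁻¹) *
          ((Real.pi : ℂ) / p * cexp (-((p * (Real.pi * t) : ℝ) : ℂ)) *
            ((1 / ((q - normSq w / p : ℝ) : ℂ)) ^ ((s + 1 - k / 2) + (s + 1 + k / 2) - 2) * Complex.Gamma (2 * s)) *
          Φ (1 - k / 2) (1 + k / 2) p s))) := by
  -- names
  set T : Matrix (Fin 2) (Fin 2) ℂ := -(a * hermTwo (t, 0, 0) * aᴴ) with hTdef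
  set Z : Matrix (Fin 2) (Fin 2) ℂ := moeb h (I • (1 : Matrix (Fin 2) (Fin 2) ℂ)) with hZ
  set d : Matrix (Fin 2) (Fin 2) ℂ := denom h (I • (1 : Matrix (Fin 2) (Fin 2) ℂ)) with hd
  set U : Matrix (Fin 2) (Fin 2) ℂ := (2 : ℂ)⁻¹ • (Z + Zᴴ) with hU
  set V : Matrix (Fin 2) (Fin 2) ℂ := (2 * I)⁻¹ • (Z - Zᴴ) with hV
  have hδ0 : d.det ≠ 0 := (isUnit_det_denom hh posDef_im_I_smul_one).ne_zero
  have hδpos : 0 < ‖d.det‖ := norm_pos_iff.mpr hδ0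
  have hδc : (((‖d.det‖ : ℝ)) : ℂ) ≠ 0 := by exact_mod_cast hδpos.ne'
  have hVpos : V.PosDef := posDef_im_moeb hh posDef_im_I_smul_one
  have hTh : T.IsHermitian := (isHermitian_mul_mul_conjTranspose a (isHermitian_hermTwo _)).neg
  have hTnpsd : (-T).PosSemidef := by
    rw [hTdef, neg_neg]
    exact posSemidef_conj_rankOne a ht.le
  -- the weight `g′ = aᴴ (2V) a > 0` in coordinates
  have ha : a.det ≠ 0 := fun h0 => by rw [h0, norm_zero] at hdet; exact zero_ne_one hdet
  have haU : IsUnit a := (Matrix.isUnit_iff_isUnit_det a).mpr (Ne.isUnit ha)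
  have h2V : ((2 : ℂ) • V).PosDef := by
    have h := hVpos.smul (by norm_num : (0 : ℝ) < 2)
    rwa [show ((2 : ℝ) • V) = ((2 : ℂ) • V) by rw [← Complex.coe_smul]; norm_num] at h
  have hg' : (aᴴ * ((2 : ℂ) • V) * a).PosDef := by
    have := Matrix.IsUnit.posDef_star_left_conjugate_iff (x := (2 : ℂ) • V) haU
    rw [Matrix.star_eq_conjTranspose] at this
    exact this.mpr h2V
  have hg'' : (hermTwo (p, w, q)).PosDef := by rw [he]; exact hg'
  obtain ⟨hp, hpq⟩ := (posDef_hermTwo_iff (p, w, q)).mp hg''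
  simp only at hp hpq
  have hπt : 0 < Real.pi * t := by positivity
  -- the continuation witness along the swapped K1 line `α₀ = 1 − k/2`, `β₀ = 1 + k/2`, at the weight parameter `p`
  have hFd := hΦa (1 - k / 2) (1 + k / 2) p hp
  have hF := hΦb (1 - k / 2) (1 + k / 2) p hp
  -- the value on `{½ < re s}`: both sides are holomorphic there and agree for `re s ≫ 0`
  -- (i) the block as a function of `s`, via ★ (3c)
  have hB : ∀ s : ℂ, (∫ r : Fin 2 → Fin 2 → ℝ, cexp (-(2 * Real.pi * I) * (T * hermOfReal r).trace) *
      archScalarSection k s (Matrix.J (Fin 2) ℂ * fromBlocks 1 (hermOfReal r) 0 1 * h)) =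
      (d.det ^ (-k) * (((‖d.det‖ : ℝ)) : ℂ) ^ ((k : ℂ) - 2 * s - 2) * cexp ((2 * Real.pi * I) * (T * U).trace)) *
        ((1 / 8 : ℂ) * xiTwo V T ((1 + k / 2) + s) ((1 - k / 2) + s)) := by
    intro s
    rw [twistedArchIntertwining_archScalarSection_eq k s hh T, ← hZ, ← hd]
    rw [show (1 + (k : ℂ) / 2) + s = s + 1 + k / 2 by ring, show (1 - (k : ℂ) / 2) + s = s + 1 - k / 2 by ring]
  -- (ii) holomorphy of the block on the half-plane `{½ < re s}`
  have hPd : Differentiable ℂ (fun s : ℂ => d.det ^ (-k) * (((‖d.det‖ : ℝ)) : ℂ) ^ ((k : ℂ) - 2 * s - 2) *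
      cexp ((2 * Real.pi * I) * (T * U).trace)) := by
    refine ((differentiable_const _).mul fun s => ?_).mul (differentiable_const _)
    exact ((((differentiableAt_const _).sub ((differentiableAt_id).const_mul _)).sub_const _).const_cpow (Or.inl hδc))
  have hXi : DifferentiableOn ℂ (fun s : ℂ => xiTwo V T ((1 + k / 2) + s) ((1 - k / 2) + s)) {s : ℂ | 1 / 2 < s.re} := by
    refine (differentiableOn_xiTwo_diag hVpos hTh (1 + k / 2) (1 - k / 2)).mono fun s hs => ?_
    simp only [mem_setOf_eq, add_re, sub_re, one_re, div_ofNat_re, intCast_re, mul_re, re_ofNat, im_ofNat, zero_mul, sub_zero] at hs ⊢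
    linarith
  have hBd : DifferentiableOn ℂ (fun s : ℂ => ∫ r : Fin 2 → Fin 2 → ℝ, cexp (-(2 * Real.pi * I) * (T * hermOfReal r).trace) *
      archScalarSection k s (Matrix.J (Fin 2) ℂ * fromBlocks 1 (hermOfReal r) 0 1 * h)) {s : ℂ | 1 / 2 < s.re} := by
    have e : (fun s : ℂ => ∫ r : Fin 2 → Fin 2 → ℝ, cexp (-(2 * Real.pi * I) * (T * hermOfReal r).trace) *
        archScalarSection k s (Matrix.J (Fin 2) ℂ * fromBlocks 1 (hermOfReal r) 0 1 * h)) =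
        fun s => (d.det ^ (-k) * (((‖d.det‖ : ℝ)) : ℂ) ^ ((k : ℂ) - 2 * s - 2) * cexp ((2 * Real.pi * I) * (T * U).trace)) *
          ((1 / 8 : ℂ) * xiTwo V T ((1 + k / 2) + s) ((1 - k / 2) + s)) := funext hB
    rw [e]
    exact hPd.differentiableOn.mul ((differentiableOn_const _).mul hXi)
  -- (iii) the agreement for `re s > |k| + 3`
  have hagree : ∀ s : ℂ, (|(k : ℝ)| + 3) < s.re →
      (∫ r : Fin 2 → Fin 2 → ℝ, cexp (-(2 * Real.pi * I) * (T * hermOfReal r).trace) *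
        archScalarSection k s (Matrix.J (Fin 2) ℂ * fromBlocks 1 (hermOfReal r) 0 1 * h)) =
      (d.det ^ (-k) * (((‖d.det‖ : ℝ)) : ℂ) ^ ((k : ℂ) - 2 * s - 2) * cexp ((2 * Real.pi * I) * (T * U).trace)) *
        ((1 / 8 : ℂ) * ((((4 * Real.pi ^ 4 : ℝ)) : ℂ) * cexp ((Real.pi * I) * ((s + 1 - k / 2) - (s + 1 + k / 2))) *
          ((Real.pi : ℂ)⁻¹ * (Complex.Gamma (s + 1 + k / 2))⁻¹) *
          ((Real.pi : ℂ)⁻¹ * (Complex.Gamma (s + 1 - k / 2))⁻¹ * (Complex.Gamma (s + 1 - k / 2 - 1))⁻¹) *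
          ((Real.pi : ℂ) / p * cexp (-((p * (Real.pi * t) : ℝ) : ℂ)) *
            ((1 / ((q - normSq w / p : ℝ) : ℂ)) ^ ((s + 1 - k / 2) + (s + 1 + k / 2) - 2) * Complex.Gamma (2 * s)) * Φ (1 - k / 2) (1 + k / 2) p s))) := by
    intro s hs
    have hk1 : -( |(k : ℝ)| ) ≤ (k : ℝ) ∧ (k : ℝ) ≤ |(k : ℝ)| := ⟨neg_abs_le _, le_abs_self _⟩
    have hα' : 1 < (s + 1 + (k : ℂ) / 2).re := by
      simp only [add_re, one_re, div_ofNat_re, intCast_re]; linarith [hk1.1]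
    have hβ' : 3 < (s + 1 - (k : ℂ) / 2).re := by
      simp only [add_re, sub_re, one_re, div_ofNat_re, intCast_re]; linarith [hk1.2]
    have hαβ : 3 < ((s + 1 - (k : ℂ) / 2) + (s + 1 + (k : ℂ) / 2)).re := by
      simp only [add_re, sub_re, one_re, div_ofNat_re, intCast_re]; linarith
    have hβline : 1 < ((1 + (k : ℂ) / 2) + s).re := by
      simp only [add_re, one_re, div_ofNat_re, intCast_re]; linarith [hk1.1]
    -- ξ → η (negative index: parameters swap), rotate the index, reduce
    rw [hB s, show (1 + (k : ℂ) / 2) + s = s + 1 + k / 2 by ring, show (1 - (k : ℂ) / 2) + s = s + 1 - k / 2 by ring,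
      xiTwo_eq_etaTwo_of_neg_posSemidef hVpos hTnpsd hα' hβ', hTdef, neg_neg, pi_smul_conj_rankOne a t,
      etaTwo_conj (isHermitian_hermTwo _) hdet ((2 : ℂ) • V), ← he, etaTwo_rankOne_eq hp hpq hπt hα' hαβ]
    -- the continued letter
    have hFs := hF s hβline
    rw [show (1 + (k : ℂ) / 2) + s - 1 = s + 1 + k / 2 - 1 by ring, show (1 - (k : ℂ) / 2) + s - 2 = s + 1 - k / 2 - 2 by ring,
      show (1 + (k : ℂ) / 2) + s - 2 = s + 1 + k / 2 - 2 by ring] at hFs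
    rw [hFs]
    -- `Γ₂(β)⁻¹ = π⁻¹ Γ(β)⁻¹ Γ(β−1)⁻¹`, `Γ₂(α)⁻¹ = π⁻¹ Γ(α)⁻¹ Γ(α−1)⁻¹`, `β + α − 2 = 2s`
    rw [hermTwoGamma_def, hermTwoGamma_def, mul_inv, mul_inv, mul_inv, mul_inv,
      show (s + 1 - (k : ℂ) / 2) + (s + 1 + (k : ℂ) / 2) - 2 = 2 * s by ring]
    ring
  -- (iv) identity theorem on the half-plane `{½ < re s}`
  have hUo : IsOpen {s : ℂ | 1 / 2 < s.re} := isOpen_lt continuous_const Complex.continuous_re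
  have hUc : IsPreconnected {s : ℂ | 1 / 2 < s.re} := (convex_halfSpace_re_gt (1 / 2)).isPreconnected
  set z₀ : ℂ := (((|(k : ℝ)| + 4 : ℝ)) : ℂ) with hz₀
  have hz₀U : z₀ ∈ {s : ℂ | 1 / 2 < s.re} := by
    simp only [mem_setOf_eq, hz₀, ofReal_re]; linarith [abs_nonneg (k : ℝ)]
  have hEd : DifferentiableOn ℂ (fun s => (d.det ^ (-k) * (((‖d.det‖ : ℝ)) : ℂ) ^ ((k : ℂ) - 2 * s - 2) * cexp ((2 * Real.pi * I) * (T * U).trace)) *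
    ((1 / 8 : ℂ) * ((((4 * Real.pi ^ 4 : ℝ)) : ℂ) * cexp ((Real.pi * I) * ((s + 1 - k / 2) - (s + 1 + k / 2))) *
      ((Real.pi : ℂ)⁻¹ * (Complex.Gamma (s + 1 + k / 2))⁻¹) *
      ((Real.pi : ℂ)⁻¹ * (Complex.Gamma (s + 1 - k / 2))⁻¹ * (Complex.Gamma (s + 1 - k / 2 - 1))⁻¹) *
      ((Real.pi : ℂ) / p * cexp (-((p * (Real.pi * t) : ℝ) : ℂ)) *
        ((1 / ((q - normSq w / p : ℝ) : ℂ)) ^ ((s + 1 - k / 2) + (s + 1 + k / 2) - 2) * Complex.Gamma (2 * s)) * Φ (1 - k / 2) (1 + k / 2) p s)))) {s : ℂ | 1 / 2 < s.re} := by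
    -- the candidate is holomorphic on `{0 < re}` (first bullet, re-derived) hence on `{½ < re}`
    have hsub : {s : ℂ | 1 / 2 < s.re} ⊆ {s : ℂ | 1 - (N : ℝ) < ((1 + k / 2 : ℂ) + s).re} := by
      intro s hs
      simp only [mem_setOf_eq, add_re, one_re, div_ofNat_re, intCast_re] at hs ⊢
      linarith
    have hsub0 : {s : ℂ | 1 / 2 < s.re} ⊆ {s : ℂ | 0 < s.re} := fun s hs => by
      simp only [mem_setOf_eq] at hs ⊢; linarith
    have hq0 : (1 / ((q - normSq w / p : ℝ) : ℂ)) ≠ 0 := by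
      have : 0 < q - normSq w / p := by rw [sub_pos, div_lt_iff₀ hp]; linarith
      exact one_div_ne_zero (by exact_mod_cast this.ne')
    have hC : Differentiable ℂ (fun s : ℂ => (((4 * Real.pi ^ 4 : ℝ)) : ℂ) * cexp ((Real.pi * I) * ((s + 1 - k / 2) - (s + 1 + k / 2))) *
        ((Real.pi : ℂ)⁻¹ * (Complex.Gamma (s + 1 + k / 2))⁻¹) *
        ((Real.pi : ℂ)⁻¹ * (Complex.Gamma (s + 1 - k / 2))⁻¹ * (Complex.Gamma (s + 1 - k / 2 - 1))⁻¹)) := by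
      refine (((differentiable_const _).mul ?_).mul ?_).mul ?_
      · exact (((differentiable_const _).mul ((((differentiable_id).add_const _).sub_const _).sub
          (((differentiable_id).add_const _).add_const _)))).cexp
      · exact (differentiable_const _).mul (Complex.differentiable_one_div_Gamma.comp (((differentiable_id).add_const _).add_const _))
      · refine ((differentiable_const _).mul ?_).mul ?_
        · exact Complex.differentiable_one_div_Gamma.comp (((differentiable_id).add_const _).sub_const _)
        · exact Complex.differentiable_one_div_Gamma.comp ((((differentiable_id).add_const _).sub_const _).sub_const _)
    have hR : DifferentiableOn ℂ (fun s : ℂ => (Real.pi : ℂ) / p * cexp (-((p * (Real.pi * t) : ℝ) : ℂ)) *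
        ((1 / ((q - normSq w / p : ℝ) : ℂ)) ^ ((s + 1 - k / 2) + (s + 1 + k / 2) - 2) * Complex.Gamma (2 * s))) {s : ℂ | 1 / 2 < s.re} := by
      refine ((differentiableOn_const _).mul ?_)
      refine DifferentiableOn.mul (fun s _ => ?_) (differentiableOn_Gamma_two_mul.mono hsub0)
      exact (((((differentiableAt_id).add_const _).sub_const _).add (((differentiableAt_id).add_const _).add_const _)).sub_const _
        |>.const_cpow (Or.inl hq0)).differentiableWithinAt
    exact hPd.differentiableOn.mul (((differentiableOn_const _).mul (hC.differentiableOn.mul (hR.mul (hFd.mono hsub)))))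
  have hev : (fun s : ℂ => ∫ r : Fin 2 → Fin 2 → ℝ, cexp (-(2 * Real.pi * I) * (T * hermOfReal r).trace) *
        archScalarSection k s (Matrix.J (Fin 2) ℂ * fromBlocks 1 (hermOfReal r) 0 1 * h)) =ᶠ[𝓝 z₀]
      (fun s => (d.det ^ (-k) * (((‖d.det‖ : ℝ)) : ℂ) ^ ((k : ℂ) - 2 * s - 2) * cexp ((2 * Real.pi * I) * (T * U).trace)) *
        ((1 / 8 : ℂ) * ((((4 * Real.pi ^ 4 : ℝ)) : ℂ) * cexp ((Real.pi * I) * ((s + 1 - k / 2) - (s + 1 + k / 2))) *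
          ((Real.pi : ℂ)⁻¹ * (Complex.Gamma (s + 1 + k / 2))⁻¹) *
          ((Real.pi : ℂ)⁻¹ * (Complex.Gamma (s + 1 - k / 2))⁻¹ * (Complex.Gamma (s + 1 - k / 2 - 1))⁻¹) *
          ((Real.pi : ℂ) / p * cexp (-((p * (Real.pi * t) : ℝ) : ℂ)) *
            ((1 / ((q - normSq w / p : ℝ) : ℂ)) ^ ((s + 1 - k / 2) + (s + 1 + k / 2) - 2) * Complex.Gamma (2 * s)) * Φ (1 - k / 2) (1 + k / 2) p s)))) := by
    have hopen : IsOpen {s : ℂ | (|(k : ℝ)| + 3) < s.re} := isOpen_lt continuous_const Complex.continuous_re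
    have hmem : z₀ ∈ {s : ℂ | (|(k : ℝ)| + 3) < s.re} := by
      simp only [mem_setOf_eq, hz₀, ofReal_re]; linarith
    filter_upwards [hopen.mem_nhds hmem] with s hs
    exact hagree s hs
  exact (hBd.analyticOnNhd hUo).eqOn_of_preconnected_of_eventuallyEq (hEd.analyticOnNhd hUo) hUc hz₀U hev hs

end Summit.HodgeConjecture.HodgeConjecture.Cruxes.HLiu418.K2LiuArchTwistedScalarBlockExplicitNeg

end
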